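import Summits.AtomisticToContinuum.Crystallization.Theorems.ReggeStarCoercivityDefectFreeCrystallizesPalmDefs
import Summits.AtomisticToContinuum.Crystallization.Theorems.MinimiserShells.Negative.LoadBearing
import Summits.AtomisticToContinuum.Crystallization.Theorems.PalmUnimodularRigidityMinimiserShellsSepReductionBad

/-!
# Junk stripping, assembly (stub JS-A of line `palm-good-law`, crux stmt-AtomisticToContinuum-13603)

Stub `stub_funnelPeriodicShellGap_of_sep` of the lead-c3 skeleton `Cruxes/DefectFreeCrystallizes/Lines/palm_good_law.lean`
(v11).  Pure bookkeeping / real arithmetic: the two junk-stripping statements (energy side JS-E and predicate side JS-P,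
taken here as HYPOTHESES) and the funnel periodic shell gap for `171/200`-separated periodic configurations (CORE_sep,
also a hypothesis) imply the funnel periodic shell gap for ALL periodic configurations of `ℝ³`.

Proof.  Given `t > 0`, take `(κ₁, s₁)` from CORE_sep at `t/2`, a common constant `C > 0` dominating both junk-stripping
constants, `A ≥ |e* + κ₁| + C`, and put `κ := κ₁/2`, `s := min {1/2, s₁/(4C), t/(2C), κ₁/(2A)}` (`exists_budget`).  Let
`Q` have `#junk ≤ s·M` (`M = #motif ≥ 1`; as `s ≤ 1/2`, some motif site is `SetGood`, `exists_setGood_of_le`) and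
`#bad ≥ t·M`.  Strip the junk (JS-E): `Q'` with `Q'.points = SetGood points`, `Q'.motif = SetGood motif sites`, so
`M' := #motif' = M − #junk ≥ M/2` (`card_motif_eq`, `Finset.card_filter_add_card_filter_not`), and
`M'·e(Q') ≤ M·e(Q) + C·#junk`.  By JS-P, `Q'` is `171/200`-separated, `#nonSetGood(Q') ≤ C·#junk ≤ C·s·M ≤ (s₁/4)·M ≤ s₁·M'`
and `#bad(Q') ≥ #bad(Q) − C·#junk ≥ t·M − (t/2)·M ≥ (t/2)·M'`; so CORE_sep gives `e* + κ₁ ≤ e(Q')`.  Finally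
`M·e(Q) ≥ M'·(e* + κ₁) − C·#junk = M(e* + κ₁) − #junk·(e* + κ₁) − C·#junk ≥ M(e* + κ₁) − s·M·(|e* + κ₁| + C)
≥ M(e* + κ₁) − s·A·M ≥ M(e* + κ₁/2)` (`arith`), and divide by `M > 0`.
-/

noncomputable section

open MeasureTheory
open scoped ENNReal BigOperators Classical

namespace Summit.AtomisticToContinuum.Crystallization.Theorems.PalmGoodLaw.FunnelGapOfSep

open Literature.MathematicalPhysics.StatisticalMechanics Literature.Geometry.DiscreteGeometry MeasureTheory
open Summit.AtomisticToContinuum.Crystallization.Theorems.MinimiserShells.Negative.LoadBearing (eStar GoodShell)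
open Summit.AtomisticToContinuum.Crystallization.Theorems.PalmUnimodularRigidityMinimiserShells.SepReductionBad
  (natCard_subtype_eq_card_filter)

/-! ## Bookkeeping of the stripped motif -/

/-- The number of junk (non-`SetGood`) motif sites is the cardinality of the corresponding filter of the motif.
[folklore] -/
theorem natCard_junk_eq (Q : PeriodicConfiguration 3) :
    Nat.card {x : Q.motif // ¬ SetGood Q.points (x : EuclideanSpace ℝ (Fin 3))} =
      (Q.motif.filter fun x => ¬ SetGood Q.points x).card :=
  natCard_subtype_eq_card_filter Q.motif fun x => ¬ SetGood Q.points x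

/-- If the motif of `Q'` is, as a set, the `SetGood` part of the motif of `Q`, then it is the corresponding filter
of the motif of `Q`. [folklore] -/
theorem motif_eq_filter {Q Q' : PeriodicConfiguration 3}
    (hmotif : (↑Q'.motif : Set (EuclideanSpace ℝ (Fin 3))) = {x | x ∈ Q.motif ∧ SetGood Q.points x}) :
    Q'.motif = Q.motif.filter fun x => SetGood Q.points x := by
  ext u
  rw [Finset.mem_filter, ← Finset.mem_coe, hmotif]
  rfl

/-- Cardinality of the stripped motif: `#motif' = #motif − #junk` (as real numbers). [folklore] -/
theorem card_motif_eq {Q Q' : PeriodicConfiguration 3}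
    (hmotif : (↑Q'.motif : Set (EuclideanSpace ℝ (Fin 3))) = {x | x ∈ Q.motif ∧ SetGood Q.points x}) :
    (Q'.motif.card : ℝ) =
      (Q.motif.card : ℝ) - (Nat.card {x : Q.motif // ¬ SetGood Q.points (x : EuclideanSpace ℝ (Fin 3))} : ℝ) := by
  rw [natCard_junk_eq Q, motif_eq_filter hmotif, eq_sub_iff_add_eq]
  exact_mod_cast Finset.card_filter_add_card_filter_not (s := Q.motif) fun x => SetGood Q.points x

/-- If at most half of the motif sites are junk, some motif site is `SetGood` (the motif is non-empty). [folklore] -/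
theorem exists_setGood_of_le {Q : PeriodicConfiguration 3} {s : ℝ} (hs : s ≤ 1 / 2)
    (hJ : (Nat.card {x : Q.motif // ¬ SetGood Q.points (x : EuclideanSpace ℝ (Fin 3))} : ℝ) ≤
      s * (Q.motif.card : ℝ)) :
    ∃ x ∈ Q.motif, SetGood Q.points x := by
  by_contra h
  push Not at h
  have hM : (0 : ℝ) < Q.motif.card := Nat.cast_pos.mpr Q.motif_nonempty.card_pos
  have hJM : (Nat.card {x : Q.motif // ¬ SetGood Q.points (x : EuclideanSpace ℝ (Fin 3))} : ℝ) =
      Q.motif.card := by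
    rw [natCard_junk_eq Q, Finset.filter_true_of_mem h]
  have h2 : s * (Q.motif.card : ℝ) ≤ 1 / 2 * Q.motif.card := mul_le_mul_of_nonneg_right hs hM.le
  linarith

/-! ## The real arithmetic -/

/-- Choice of the funnel budget `s = min {1/2, s₁/(4C), t/(2C), κ₁/(2A)}`. [folklore] -/
theorem exists_budget {C A s₁ t κ₁ : ℝ} (hC : 0 < C) (hA : 0 < A) (hs₁ : 0 < s₁) (ht : 0 < t) (hκ₁ : 0 < κ₁) :
    ∃ s : ℝ, 0 < s ∧ s ≤ 1 / 2 ∧ C * s ≤ s₁ / 4 ∧ C * s ≤ t / 2 ∧ A * s ≤ κ₁ / 2 := by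
  refine ⟨min (1 / 2) (min (s₁ / (4 * C)) (min (t / (2 * C)) (κ₁ / (2 * A)))), by positivity,
    min_le_left _ _, ?_, ?_, ?_⟩
  · have h : min (1 / 2) (min (s₁ / (4 * C)) (min (t / (2 * C)) (κ₁ / (2 * A)))) ≤ s₁ / (4 * C) :=
      (min_le_right _ _).trans (min_le_left _ _)
    rw [le_div_iff₀ (by positivity)] at h
    linarith
  · have h : min (1 / 2) (min (s₁ / (4 * C)) (min (t / (2 * C)) (κ₁ / (2 * A)))) ≤ t / (2 * C) :=
      (min_le_right _ _).trans ((min_le_right _ _).trans (min_le_left _ _))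
    rw [le_div_iff₀ (by positivity)] at h
    linarith
  · have h : min (1 / 2) (min (s₁ / (4 * C)) (min (t / (2 * C)) (κ₁ / (2 * A)))) ≤ κ₁ / (2 * A) :=
      (min_le_right _ _).trans ((min_le_right _ _).trans (min_le_right _ _))
    rw [le_div_iff₀ (by positivity)] at h
    linarith

/-- The real arithmetic of the assembly: with `M' = M − J`, `J ≤ s·M`, `t·M ≤ b`, the predicate transfer
`n' ≤ C_P·J`, `b ≤ b' + C_P·J`, the energy transfer `M'·e' ≤ M·e + C_E·J`, CORE_sep for the stripped configuration
and the budget inequalities, `E + κ₁/2 ≤ e`. [folklore] -/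
theorem arith {M M' J e e' n' b b' CE CP C A E κ₁ s₁ t s : ℝ}
    (hM : 0 < M) (hM' : M' = M - J) (hJ0 : 0 ≤ J) (hJ : J ≤ s * M) (hb : t * M ≤ b)
    (hn' : n' ≤ CP * J) (hb' : b ≤ b' + CP * J) (hEn : M' * e' ≤ M * e + CE * J)
    (hgap : n' ≤ s₁ * M' → t / 2 * M' ≤ b' → E + κ₁ ≤ e')
    (hCEC : CE ≤ C) (hCPC : CP ≤ C) (hC : 0 < C) (hA : |E + κ₁| + C ≤ A)
    (hs₁ : 0 < s₁) (ht : 0 < t) (hs0 : 0 < s) (hs : s ≤ 1 / 2)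
    (hs1 : C * s ≤ s₁ / 4) (hst : C * s ≤ t / 2) (hsA : A * s ≤ κ₁ / 2) :
    E + κ₁ / 2 ≤ e := by
  have hsM : s * M ≤ 1 / 2 * M := mul_le_mul_of_nonneg_right hs hM.le
  have hJM : J ≤ 1 / 2 * M := hJ.trans hsM
  have hM'pos : 0 < M' := by rw [hM']; linarith
  have hCJ : C * J ≤ C * (s * M) := mul_le_mul_of_nonneg_left hJ hC.le
  have hCPJ : CP * J ≤ C * J := mul_le_mul_of_nonneg_right hCPC hJ0
  have hCEJ : CE * J ≤ C * J := mul_le_mul_of_nonneg_right hCEC hJ0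
  have hs₁M : 0 ≤ s₁ * M := by positivity
  have h1 : C * s * M ≤ s₁ / 4 * M := mul_le_mul_of_nonneg_right hs1 hM.le
  have h1' : s₁ * J ≤ s₁ * (1 / 2 * M) := mul_le_mul_of_nonneg_left hJM hs₁.le
  have hn'' : n' ≤ s₁ * M' := by rw [hM']; linarith
  have h2 : C * s * M ≤ t / 2 * M := mul_le_mul_of_nonneg_right hst hM.le
  have h2' : 0 ≤ t * J := mul_nonneg ht.le hJ0
  have hb'' : t / 2 * M' ≤ b' := by rw [hM']; linarith
  have hgap' : E + κ₁ ≤ e' := hgap hn'' hb''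
  have h3 : M' * (E + κ₁) ≤ M' * e' := mul_le_mul_of_nonneg_left hgap' hM'pos.le
  rw [hM'] at h3 hEn
  have h4 : J * (E + κ₁) ≤ J * |E + κ₁| := mul_le_mul_of_nonneg_left (le_abs_self _) hJ0
  have h5 : J * |E + κ₁| ≤ s * M * |E + κ₁| := mul_le_mul_of_nonneg_right hJ (abs_nonneg _)
  have h7 : s * M * (|E + κ₁| + C) ≤ s * M * A := mul_le_mul_of_nonneg_left hA (by positivity)
  have h8 : A * s * M ≤ κ₁ / 2 * M := mul_le_mul_of_nonneg_right hsA hM.le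
  have key : M * (E + κ₁ / 2) ≤ M * e := by linarith
  exact le_of_mul_le_mul_left key hM

/-! ## The stub -/

/-- **Stub `stub_funnelPeriodicShellGap_of_sep` (JS-A) of line `palm-good-law`.**  ASSEMBLY OF THE JUNK STRIPPING:
the energy side (JS-E), the predicate side (JS-P) and the funnel periodic shell gap for `171/200`-separated periodic
configurations (CORE_sep) imply the funnel periodic shell gap for all periodic configurations of `ℝ³`.  Given `t`,
take `(κ₁, s₁)` from CORE_sep at `t/2`, `κ := κ₁/2` and `s := min {1/2, s₁/(4C), t/(2C), κ₁/(2A)}` (`C` a common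
positive junk-stripping constant, `A = |e* + κ₁| + C + 1`; `exists_budget`); some motif site is `SetGood`
(`exists_setGood_of_le`), strip (JS-E), transfer the predicates (JS-P), read off `#motif' = #motif − #junk`
(`card_motif_eq`) and conclude by `arith`. [folklore] -/
theorem stub_funnelPeriodicShellGap_of_sep :
    (∃ C : ℝ, 0 ≤ C ∧ ∀ Q : Literature.MathematicalPhysics.StatisticalMechanics.PeriodicConfiguration 3,
      (∃ x ∈ Q.motif, SetGood Q.points x) →
      ∃ Q' : Literature.MathematicalPhysics.StatisticalMechanics.PeriodicConfiguration 3,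
        Q'.points = {x | x ∈ Q.points ∧ SetGood Q.points x} ∧
        (↑Q'.motif : Set (EuclideanSpace ℝ (Fin 3))) = {x | x ∈ Q.motif ∧ SetGood Q.points x} ∧
        (Q'.motif.card : ℝ) * Q'.energyPerParticle lennardJones ≤
          (Q.motif.card : ℝ) * Q.energyPerParticle lennardJones +
            C * (Nat.card {x : Q.motif // ¬ SetGood Q.points (x : EuclideanSpace ℝ (Fin 3))} : ℝ)) →
    (∃ C : ℝ, 0 ≤ C ∧ ∀ Q Q' : Literature.MathematicalPhysics.StatisticalMechanics.PeriodicConfiguration 3,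
      Q'.points = {x | x ∈ Q.points ∧ SetGood Q.points x} →
      (↑Q'.motif : Set (EuclideanSpace ℝ (Fin 3))) = {x | x ∈ Q.motif ∧ SetGood Q.points x} →
      (∀ x ∈ Q'.points, ∀ z ∈ Q'.points, x ≠ z → (171 / 200 : ℝ) ≤ dist x z) ∧
      (Nat.card {x : Q'.motif // ¬ SetGood Q'.points (x : EuclideanSpace ℝ (Fin 3))} : ℝ) ≤
        C * (Nat.card {x : Q.motif // ¬ SetGood Q.points (x : EuclideanSpace ℝ (Fin 3))} : ℝ) ∧
      (Nat.card {x : Q.motif // ¬ GoodShell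
          ((Measure.count : Measure (EuclideanSpace ℝ (Fin 3))).restrict
            ((fun z => z - (x : EuclideanSpace ℝ (Fin 3))) '' Q.points))} : ℝ) ≤
        (Nat.card {x : Q'.motif // ¬ GoodShell
          ((Measure.count : Measure (EuclideanSpace ℝ (Fin 3))).restrict
            ((fun z => z - (x : EuclideanSpace ℝ (Fin 3))) '' Q'.points))} : ℝ) +
        C * (Nat.card {x : Q.motif // ¬ SetGood Q.points (x : EuclideanSpace ℝ (Fin 3))} : ℝ)) →
    (∀ t : ℝ, 0 < t → ∃ κ : ℝ, 0 < κ ∧ ∃ s : ℝ, 0 < s ∧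
      ∀ Q : Literature.MathematicalPhysics.StatisticalMechanics.PeriodicConfiguration 3,
        (∀ x ∈ Q.points, ∀ z ∈ Q.points, x ≠ z → (171 / 200 : ℝ) ≤ dist x z) →
        (Nat.card {x : Q.motif // ¬ SetGood Q.points (x : EuclideanSpace ℝ (Fin 3))} : ℝ) ≤
            s * (Q.motif.card : ℝ) →
        t * (Q.motif.card : ℝ) ≤ (Nat.card {x : Q.motif // ¬ GoodShell
            ((Measure.count : Measure (EuclideanSpace ℝ (Fin 3))).restrict
              ((fun z => z - (x : EuclideanSpace ℝ (Fin 3))) '' Q.points))} : ℝ) →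
        eStar + κ ≤ Q.energyPerParticle lennardJones) →
    ∀ t : ℝ, 0 < t → ∃ κ : ℝ, 0 < κ ∧ ∃ s : ℝ, 0 < s ∧
      ∀ Q : Literature.MathematicalPhysics.StatisticalMechanics.PeriodicConfiguration 3,
        (Nat.card {x : Q.motif // ¬ SetGood Q.points (x : EuclideanSpace ℝ (Fin 3))} : ℝ) ≤
            s * (Q.motif.card : ℝ) →
        t * (Q.motif.card : ℝ) ≤ (Nat.card {x : Q.motif // ¬ GoodShell
            ((Measure.count : Measure (EuclideanSpace ℝ (Fin 3))).restrict
              ((fun z => z - (x : EuclideanSpace ℝ (Fin 3))) '' Q.points))} : ℝ) →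
        eStar + κ ≤ Q.energyPerParticle lennardJones := by
  rintro ⟨CE, hCE, hE⟩ ⟨CP, hCP, hP⟩ hsep t ht
  obtain ⟨κ₁, hκ₁, s₁, hs₁, hgap⟩ := hsep (t / 2) (half_pos ht)
  obtain ⟨C, hCEC, hCPC, hC⟩ : ∃ C : ℝ, CE ≤ C ∧ CP ≤ C ∧ 0 < C :=
    ⟨CE + CP + 1, by linarith, by linarith, by linarith⟩
  obtain ⟨A, hA, hA0⟩ : ∃ A : ℝ, |eStar + κ₁| + C ≤ A ∧ 0 < A :=
    ⟨|eStar + κ₁| + C + 1, by linarith, by positivity⟩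
  obtain ⟨s, hs0, hs, hs1, hst, hsA⟩ := exists_budget hC hA0 hs₁ ht hκ₁
  refine ⟨κ₁ / 2, half_pos hκ₁, s, hs0, fun Q hJ hb => ?_⟩
  obtain ⟨Q', hpts, hmotif, hEn⟩ := hE Q (exists_setGood_of_le hs hJ)
  obtain ⟨hsepQ', hn', hb'⟩ := hP Q Q' hpts hmotif
  have hM : (0 : ℝ) < Q.motif.card := Nat.cast_pos.mpr Q.motif_nonempty.card_pos
  exact arith hM (card_motif_eq hmotif) (Nat.cast_nonneg _) hJ hb hn' hb' hEn (hgap Q' hsepQ') hCEC hCPC hC hA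
    hs₁ ht hs0 hs hs1 hst hsA

end Summit.AtomisticToContinuum.Crystallization.Theorems.PalmGoodLaw.FunnelGapOfSep

end
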